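import Summits.Ventures.CertifiedArithmetic.LowPrec.GemmLowTrajectories
import Summits.Ventures.CertifiedArithmetic.LowPrec.GemmTieChainFamilies

/-!
# E2M1² → bfloat16, sequential RNE: the LOW-TRAJECTORY bound for every length (gemm.tex Lemma l:low)

HONEST FRAMING (venture CertifiedArithmetic / cell `pub-lowprec`): certified error envelopes and
provably optimal rounding/accumulation schemes for low-precision formats under stated cost models;
every table by two implementations; no hardware or vendor claims.

Setting of `GemmTieChains.lean` / `paper/gemm.tex` Prop. `p:sandwich`: letters `pᵢ ∈ Π(E2M1,E2M1)`,
accumulated sequentially in `bfloat16` under the cell's saturating round-to-nearest-even (`seqSum`),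
`E = |ŝ - s|`, `L = Σ|pᵢ|`, `R = E/L`. An input is LOW when every exact intermediate
`xⱼ = ŝⱼ₋₁ + pⱼ` has `|xⱼ| < 128` (`LowTraj`).

THEOREM (`abs_seqSum_sub_sum_le_low` / `low_trajectory_bound` / `low_trajectory_ratio`; gemm.tex
Lemma `l:low`, listed in its §Lean as "not kernel-checked"): for EVERY `n ≥ 3` and every low
input, `|ŝ - s| ≤ max((n-2)/(286+n), (n-3)/(253+n)) · Σ|pᵢ|`; and `low_trajectory_max`: together
with the two tie-chain families of `GemmTieChainFamilies.lean` (which are low and attain the two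
values for every `n`) the paper's `max{R : low inputs, L > 0} = max((n-2)/(286+n), (n-3)/(253+n))`
holds for ALL `n ≥ 3` — an all-`n` theorem; the certificates decide the unrestricted `W(n)` row by
row (`n ≤ 1024`), and `W(n)` exceeds the low value first at `n = 132` through a non-low input.

Proof = the paper's accounting made explicit (`LowInv`): along a low trajectory every `ŝⱼ ∈ ¼ℤ`
(toolkit file), an inexact step costs at most `¼` of error and carries a letter of modulus `≥ ¼`;
the FIRST inexact step has index `k₁ ≥ 2` (`W(2) = 0`) with prior mass `A ≥ 72¼` if `k₁ = 2`
(`mass_three_of_entry`) and `A ≥ |x_{k₁}| ≥ 64¼` if `k₁ ≥ 3`; hence `E ≤ N/4`, `L ≥ A + (N-1)/4`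
with `N ≤ n - k₁` inexact steps, and `N/(4A+N-1)` is increasing in `N`, decreasing in `A`.
-/

namespace Literature.ComputerArithmetic.FloatingPoint

namespace MiniFloat

open Finset Format
open Literature.ComputerArithmetic.JeannerodRump2018

/-! ### The low-trajectory hypothesis and the bookkeeping invariant -/

/-- LOW input of length `m + 1`: every exact intermediate `ŝₖ + xₖ₊₁`, `k < m`, has modulus
`< 128`. [cell, gemm.tex Lemma l:low] -/
def LowTraj (x : ℕ → ℚ) (m : ℕ) : Prop :=
  ∀ k < m, |(seqSum Format.BFloat16 x k).toRat + x (k + 1)| < 128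

/-- `LowTraj` is monotone in the length. [folklore] -/
theorem LowTraj.mono {x : ℕ → ℚ} {m k : ℕ} (h : LowTraj x m) (hk : k ≤ m) : LowTraj x k :=
  fun j hj => h j (by omega)

/-- The bookkeeping invariant after `k + 1` letters: the accumulator is a quarter-integer of
modulus `≤ 128`, and either no rounding error has occurred, or `N ≥ 1` inexact steps have, with
`|ŝ - s| ≤ N/4`, mass `Σ|p| ≥ A + (N-1)/4`, and (`A ≥ 72¼`, `N ≤ k-1`) or (`A ≥ 64¼`, `N ≤ k-2`).
[cell, gemm.tex Lemma l:low] -/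
def LowInv (x : ℕ → ℚ) (k : ℕ) : Prop :=
  (∃ z : ℤ, (seqSum Format.BFloat16 x k).toRat = (z : ℚ) / 4) ∧
  |(seqSum Format.BFloat16 x k).toRat| ≤ 128 ∧
  ((seqSum Format.BFloat16 x k).toRat = ∑ j ∈ range (k + 1), x j ∨
    ∃ (N : ℕ) (A : ℚ), 1 ≤ N ∧
      |(seqSum Format.BFloat16 x k).toRat - ∑ j ∈ range (k + 1), x j| ≤ (N : ℚ) / 4 ∧
      A + ((N : ℚ) - 1) / 4 ≤ ∑ j ∈ range (k + 1), |x j| ∧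
      ((289 / 4 ≤ A ∧ N + 1 ≤ k) ∨ (257 / 4 ≤ A ∧ N + 2 ≤ k)))

/-- Base: after two letters the accumulation is exact (`W(2) = 0`). [cell] -/
theorem lowInv_one (x : ℕ → ℚ) (hx : ∀ j, x j ∈ piE2M1) : LowInv x 1 := by
  have h0 : (seqSum Format.BFloat16 x 0).toRat = x 0 := roundNE_of_mem_piE2M1 _ (hx 0)
  have h1 : (seqSum Format.BFloat16 x 1).toRat = x 0 + x 1 := by
    show (roundNE _ ((seqSum Format.BFloat16 x 0).toRat + x 1)).toRat = _
    rw [h0]; exact roundNE_add_of_mem_piE2M1 _ (hx 0) _ (hx 1)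
  obtain ⟨z0, hz0⟩ := exists_eq_div_four_of_mem_piE2M1 _ (hx 0)
  obtain ⟨z1, hz1⟩ := exists_eq_div_four_of_mem_piE2M1 _ (hx 1)
  have ha := (letter_facts _ (hx 0)).1
  have hb := (letter_facts _ (hx 1)).1
  refine ⟨⟨z0 + z1, by rw [h1, hz0, hz1]; push_cast; ring⟩, ?_, Or.inl ?_⟩
  · rw [h1]; have := abs_add_le (x 0) (x 1); linarith
  · rw [h1, sum_range_succ, sum_range_one]

/-- Step of the invariant along a low trajectory. [cell, gemm.tex Lemma l:low] -/
theorem lowInv_succ (x : ℕ → ℚ) (hx : ∀ j, x j ∈ piE2M1) {k : ℕ} (hk : 1 ≤ k)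
    (hlow : |(seqSum Format.BFloat16 x k).toRat + x (k + 1)| < 128) (hinv : LowInv x k) :
    LowInv x (k + 1) := by
  obtain ⟨⟨z, hz⟩, hle, hacc⟩ := hinv
  obtain ⟨zp, hzp⟩ := exists_eq_div_four_of_mem_piE2M1 _ (hx (k + 1))
  obtain ⟨hp36, hp0, -, -⟩ := letter_facts _ (hx (k + 1))
  set v := (seqSum Format.BFloat16 x k).toRat with hv
  set X := v + x (k + 1) with hXdef
  have hXq : X = ((z + zp : ℤ) : ℚ) / 4 := by rw [hXdef, hz, hzp]; push_cast; ring
  have hzz : |z + zp| < 512 := by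
    have h1 : |X| < 128 := hlow
    rw [hXq, abs_div, abs_of_pos (by norm_num : (0:ℚ) < 4)] at h1
    have : |((z + zp : ℤ) : ℚ)| < 512 := by linarith
    exact_mod_cast this
  obtain ⟨herr, hquart, hval, hinex⟩ := roundNE_quarter hzz
  rw [← hXq] at herr hquart hval hinex
  have hstep : (seqSum Format.BFloat16 x (k + 1)).toRat = (roundNE Format.BFloat16 X).toRat := rfl
  refine ⟨by rw [hstep]; exact hquart, by rw [hstep]; exact hval, ?_⟩
  rw [hstep, sum_range_succ x (k + 1), sum_range_succ (fun j => |x j|) (k + 1)]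
  have hSL : |∑ j ∈ range (k + 1), x j| ≤ ∑ j ∈ range (k + 1), |x j| := abs_sum_le_sum_abs _ _
  set S := ∑ j ∈ range (k + 1), x j with hS
  set L := ∑ j ∈ range (k + 1), |x j| with hL_def
  have hxabs : 0 ≤ |x (k + 1)| := abs_nonneg _
  by_cases hex : (roundNE Format.BFloat16 X).toRat = X
  · -- exact step: bookkeeping unchanged
    rw [hex]
    rcases hacc with h | ⟨N, A, hN, hE, hL, hcase⟩
    · left; rw [hXdef, h]
    · right
      have e1 : X - (S + x (k + 1)) = v - S := by rw [hXdef]; ring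
      refine ⟨N, A, hN, by rw [e1]; exact hE, by linarith, ?_⟩
      rcases hcase with ⟨hA, hNk⟩ | ⟨hA, hNk⟩
      · exact Or.inl ⟨hA, by omega⟩
      · exact Or.inr ⟨hA, by omega⟩
  · -- inexact step: error `≤ ¼` more, mass `≥ ¼` more (`p ≠ 0`)
    obtain ⟨hbig, hodd⟩ := hinex hex
    have hp_ne : x (k + 1) ≠ 0 := by
      intro h0
      apply hex
      rw [hXdef, h0, add_zero, hv, toRat_roundNE_toRat]
    have hpq : 1 / 4 ≤ |x (k + 1)| := hp0 hp_ne
    right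
    rcases hacc with h | ⟨N, A, hN, hE, hL, hcase⟩
    · -- FIRST inexact step, at index `k + 1 ≥ 2`
      have hXS : X = S + x (k + 1) := by rw [hXdef, h]
      have hXge : 257 / 4 ≤ |X| := by
        rw [hXq, abs_div, abs_of_pos (by norm_num : (0:ℚ) < 4)]
        have : (257 : ℚ) ≤ |((z + zp : ℤ) : ℚ)| := by exact_mod_cast hbig
        linarith
      have hmass : |X| ≤ L + |x (k + 1)| := by
        rw [hXS]; exact le_trans (abs_add_le _ _) (by linarith [hSL])
      have hE1 : |(roundNE Format.BFloat16 X).toRat - (S + x (k + 1))| ≤ ((1 : ℕ) : ℚ) / 4 := by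
        rw [← hXS]; push_cast; linarith [herr]
      have hL1 : (L + |x (k + 1)|) + (((1 : ℕ) : ℚ) - 1) / 4 ≤ L + |x (k + 1)| := by
        push_cast; linarith
      refine ⟨1, L + |x (k + 1)|, le_rfl, hE1, hL1, ?_⟩
      rcases Nat.lt_or_ge k 2 with hk2 | hk2
      · -- `k = 1`: the entry happens at the third letter; mass `≥ 72¼`
        left
        obtain rfl : k = 1 := by omega
        refine ⟨?_, le_rfl⟩
        have hS3 : S = x 0 + x 1 := by rw [hS, sum_range_succ, sum_range_one]
        have hXabc : X = x 0 + x 1 + x 2 := by rw [hXS, hS3]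
        have hnh : ¬ ∃ w : ℤ, x 0 + x 1 + x 2 = (w : ℚ) / 2 := by
          rintro ⟨w, hw⟩
          apply hodd
          have : ((z + zp : ℤ) : ℚ) = 2 * w := by
            have h1 : X = (w : ℚ) / 2 := by rw [hXabc, hw]
            rw [hXq] at h1; linarith
          exact ⟨w, by exact_mod_cast this⟩
        have h64 : 64 ≤ |x 0 + x 1 + x 2| := by rw [← hXabc]; linarith
        have hL3 : L = |x 0| + |x 1| := by rw [hL_def, sum_range_succ, sum_range_one]
        have := mass_three_of_entry (hx 0) (hx 1) (hx 2) h64 hnh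
        rw [hL3]; linarith
      · right; exact ⟨le_trans hXge hmass, by omega⟩
    · -- a later inexact step
      have e1 : (roundNE Format.BFloat16 X).toRat - (S + x (k + 1))
          = ((roundNE Format.BFloat16 X).toRat - X) + (v - S) := by
        rw [hXdef]; ring
      have hE1 : |(roundNE Format.BFloat16 X).toRat - (S + x (k + 1))| ≤ ((N + 1 : ℕ) : ℚ) / 4 := by
        rw [e1]; push_cast
        exact le_trans (abs_add_le _ _) (by linarith)
      have hL1 : A + (((N + 1 : ℕ) : ℚ) - 1) / 4 ≤ L + |x (k + 1)| := by
        push_cast; linarith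
      refine ⟨N + 1, A, by omega, hE1, hL1, ?_⟩
      rcases hcase with ⟨hA, hNk⟩ | ⟨hA, hNk⟩
      · exact Or.inl ⟨hA, by omega⟩
      · exact Or.inr ⟨hA, by omega⟩

/-- The invariant holds along every low trajectory of length `≥ 2`. [cell, gemm.tex Lemma l:low] -/
theorem lowInv_of_lowTraj (x : ℕ → ℚ) (hx : ∀ j, x j ∈ piE2M1) :
    ∀ m, 1 ≤ m → LowTraj x m → LowInv x m
  | 0, h, _ => absurd h (by omega)
  | 1, _, _ => lowInv_one x hx
  | m + 2, _, hlow =>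
      lowInv_succ x hx (k := m + 1) (by omega) (hlow (m + 1) (by omega))
        (lowInv_of_lowTraj x hx (m + 1) (by omega) (hlow.mono (by omega)))

/-! ### The theorem -/

/-- The final inequality: `E ≤ N/4`, `L ≥ A + (N-1)/4`, `N ≤ N₀`, `A ≥ A₀ > ¼` give
`E ≤ N₀/(4A₀ + N₀ - 1) · L`. [cell, gemm.tex Lemma l:low] -/
theorem ratio_bound {E L A A0 : ℚ} {N N0 : ℕ} (hE : E ≤ (N : ℚ) / 4)
    (hL : A + ((N : ℚ) - 1) / 4 ≤ L) (hN : N ≤ N0) (hA : A0 ≤ A) (hA0 : 1 / 4 < A0) :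
    E ≤ (N0 : ℚ) / (4 * A0 + N0 - 1) * L := by
  have hNq : (N : ℚ) ≤ N0 := by exact_mod_cast hN
  have hNn : (0 : ℚ) ≤ N := Nat.cast_nonneg N
  have hN0n : (0 : ℚ) ≤ N0 := Nat.cast_nonneg N0
  have hden : 0 < 4 * A0 + (N0 : ℚ) - 1 := by linarith
  rw [div_mul_eq_mul_div, le_div_iff₀ hden]
  have hL0 : A0 + ((N : ℚ) - 1) / 4 ≤ L := by linarith
  have key : (N : ℚ) / 4 * (4 * A0 + N0 - 1) ≤ N0 * (A0 + ((N : ℚ) - 1) / 4) := by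
    nlinarith [mul_nonneg (sub_nonneg.mpr hNq) (by linarith : (0 : ℚ) ≤ 4 * A0 - 1)]
  calc E * (4 * A0 + ↑N0 - 1) ≤ (N : ℚ) / 4 * (4 * A0 + N0 - 1) :=
        mul_le_mul_of_nonneg_right hE hden.le
    _ ≤ N0 * (A0 + ((N : ℚ) - 1) / 4) := key
    _ ≤ N0 * L := mul_le_mul_of_nonneg_left hL0 (by positivity)

/-- **LEMMA l:low (gemm.tex), FOR EVERY LENGTH**: for letters `x j ∈ Π(E2M1,E2M1)` accumulated
sequentially in `bfloat16` (RNE), `m + 1 ≥ 3` letters, along a LOW trajectory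
(`|ŝₖ + xₖ₊₁| < 128` for all `k < m`):
`|ŝₘ - Σ_{j≤m} x j| ≤ max((m-1)/(287+m), (m-2)/(254+m)) · Σ_{j≤m} |x j|`
(`= max((n-2)/(286+n), (n-3)/(253+n))` with `n = m+1` letters). [cell, gemm.tex Lemma l:low] -/
theorem abs_seqSum_sub_sum_le_low (x : ℕ → ℚ) (hx : ∀ j, x j ∈ piE2M1) (m : ℕ) (hm : 2 ≤ m)
    (hlow : LowTraj x m) :
    |(seqSum Format.BFloat16 x m).toRat - ∑ j ∈ range (m + 1), x j|
      ≤ max (((m : ℚ) - 1) / (287 + m)) (((m : ℚ) - 2) / (254 + m)) * ∑ j ∈ range (m + 1), |x j| := by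
  have hmq : (2 : ℚ) ≤ m := by exact_mod_cast hm
  have hL0 : 0 ≤ ∑ j ∈ range (m + 1), |x j| := sum_nonneg (fun j _ => abs_nonneg _)
  have hc0 : 0 ≤ max (((m : ℚ) - 1) / (287 + m)) (((m : ℚ) - 2) / (254 + m)) :=
    le_trans (div_nonneg (by linarith) (by linarith)) (le_max_left _ _)
  obtain ⟨-, -, hacc⟩ := lowInv_of_lowTraj x hx m (by omega) hlow
  rcases hacc with h | ⟨N, A, hN, hE, hL, hcase⟩
  · rw [h, sub_self, abs_zero]; exact mul_nonneg hc0 hL0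
  · rcases hcase with ⟨hA, hNk⟩ | ⟨hA, hNk⟩
    · have h1 := ratio_bound hE hL (show N ≤ m - 1 by omega) hA (by norm_num)
      have e : ((m - 1 : ℕ) : ℚ) / (4 * (289 / 4) + ((m - 1 : ℕ) : ℚ) - 1) = ((m : ℚ) - 1) / (287 + m) := by
        rw [Nat.cast_sub (by omega)]; push_cast; ring_nf
      rw [e] at h1
      exact le_trans h1 (mul_le_mul_of_nonneg_right (le_max_left _ _) hL0)
    · have h1 := ratio_bound hE hL (show N ≤ m - 2 by omega) hA (by norm_num)
      have e : ((m - 2 : ℕ) : ℚ) / (4 * (257 / 4) + ((m - 2 : ℕ) : ℚ) - 1) = ((m : ℚ) - 2) / (254 + m) := by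
        rw [Nat.cast_sub (by omega)]; push_cast; ring_nf
      rw [e] at h1
      exact le_trans h1 (mul_le_mul_of_nonneg_right (le_max_right _ _) hL0)

/-- The same in the paper's variables (`n ≥ 3` letters `x 0, …, x (n-1)`): along a low trajectory
`|ŝ - s| ≤ max((n-2)/(286+n), (n-3)/(253+n)) · Σ|xᵢ|`; the two values are attained for every `n`
by the low families `bf16_72`, `bf16_64` (`GemmTieChainFamilies.bf16_72_ratio`, `bf16_64_ratio`).
[cell, gemm.tex Lemma l:low] -/
theorem low_trajectory_bound (x : ℕ → ℚ) (hx : ∀ j, x j ∈ piE2M1) (n : ℕ) (hn : 3 ≤ n)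
    (hlow : LowTraj x (n - 1)) :
    |(seqSum Format.BFloat16 x (n - 1)).toRat - ∑ i ∈ range n, x i|
      ≤ max (((n : ℚ) - 2) / (286 + n)) (((n : ℚ) - 3) / (253 + n)) * ∑ i ∈ range n, |x i| := by
  obtain ⟨m, rfl⟩ : ∃ m, n = m + 1 := ⟨n - 1, by omega⟩
  rw [Nat.add_sub_cancel] at hlow ⊢
  have h := abs_seqSum_sub_sum_le_low x hx m (by omega) hlow
  have e1 : ((m : ℚ) - 1) / (287 + m) = (((m + 1 : ℕ) : ℚ) - 2) / (286 + ((m + 1 : ℕ) : ℚ)) := by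
    push_cast; ring_nf
  have e2 : ((m : ℚ) - 2) / (254 + m) = (((m + 1 : ℕ) : ℚ) - 3) / (253 + ((m + 1 : ℕ) : ℚ)) := by
    push_cast; ring_nf
  rwa [e1, e2] at h

/-- The relative form: for a low input with positive mass, `R = |ŝ - s|/Σ|xᵢ| ≤ max(…)`.
[cell, gemm.tex Lemma l:low] -/
theorem low_trajectory_ratio (x : ℕ → ℚ) (hx : ∀ j, x j ∈ piE2M1) (n : ℕ) (hn : 3 ≤ n)
    (hlow : LowTraj x (n - 1)) (hL : 0 < ∑ i ∈ range n, |x i|) :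
    |(seqSum Format.BFloat16 x (n - 1)).toRat - ∑ i ∈ range n, x i| / ∑ i ∈ range n, |x i|
      ≤ max (((n : ℚ) - 2) / (286 + n)) (((n : ℚ) - 3) / (253 + n)) := by
  rw [div_le_iff₀ hL]
  exact low_trajectory_bound x hx n hn hlow

/-! ### The two low families attain the bound: the paper's equality for every `n` -/

/-- The family `(36, 36, ¼, ¼, …)` is low (intermediates `72`, then `72¼`). [cell] -/
theorem lowTraj_bf16_72 (m : ℕ) : LowTraj TieChain.bf16_72 m := by
  intro k _
  rcases Nat.eq_zero_or_pos k with rfl | hk1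
  · decide +kernel
  · rw [(TieChain.bf16_72_spec k hk1).1, show TieChain.bf16_72 (k + 1) = 1 / 4 from getD_tail [36, 36] _ (m := 1) rfl (k + 1) (by omega)]
    norm_num

/-- The family `(36, 24, 4, ¼, ¼, …)` is low (intermediates `60`, `64`, then `64¼`). [cell] -/
theorem lowTraj_bf16_64 (m : ℕ) : LowTraj TieChain.bf16_64 m := by
  intro k _
  rcases Nat.lt_or_ge k 2 with hk | hk
  · obtain rfl | rfl : k = 0 ∨ k = 1 := by omega
    · decide +kernel
    · decide +kernel
  · rw [(TieChain.bf16_64_spec k hk).1, show TieChain.bf16_64 (k + 1) = 1 / 4 from getD_tail [36, 24, 4] _ (m := 2) rfl (k + 1) (by omega)]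
    norm_num

/-- **gemm.tex LEMMA l:low AS AN EQUALITY, FOR EVERY `n ≥ 3`**: over the low inputs of length `n`
with positive mass, the maximum of `R = |ŝ - s| / Σ|pᵢ|` is EXACTLY
`max((n-2)/(286+n), (n-3)/(253+n))` — the bound holds for every low input, and each of the two
values is attained by a low input of letters of `Π(E2M1,E2M1)` (the tie-chain families
`TieChain.bf16_72`, `TieChain.bf16_64`). [cell, gemm.tex Lemma l:low] -/
theorem low_trajectory_max (n : ℕ) (hn : 3 ≤ n) :
    (∀ x : ℕ → ℚ, (∀ j, x j ∈ piE2M1) → LowTraj x (n - 1) → 0 < ∑ i ∈ range n, |x i| →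
      |(seqSum Format.BFloat16 x (n - 1)).toRat - ∑ i ∈ range n, x i| / ∑ i ∈ range n, |x i|
        ≤ max (((n : ℚ) - 2) / (286 + n)) (((n : ℚ) - 3) / (253 + n))) ∧
    (∃ x : ℕ → ℚ, (∀ j, x j ∈ piE2M1) ∧ LowTraj x (n - 1) ∧ 0 < ∑ i ∈ range n, |x i| ∧
      |(seqSum Format.BFloat16 x (n - 1)).toRat - ∑ i ∈ range n, x i| / ∑ i ∈ range n, |x i|
        = ((n : ℚ) - 2) / (286 + n)) ∧
    (∃ x : ℕ → ℚ, (∀ j, x j ∈ piE2M1) ∧ LowTraj x (n - 1) ∧ 0 < ∑ i ∈ range n, |x i| ∧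
      |(seqSum Format.BFloat16 x (n - 1)).toRat - ∑ i ∈ range n, x i| / ∑ i ∈ range n, |x i|
        = ((n : ℚ) - 3) / (253 + n)) := by
  obtain ⟨k, rfl⟩ : ∃ k, n = k + 1 := ⟨n - 1, by omega⟩
  have hk72 := (TieChain.bf16_72_spec k (by omega)).2.2
  have hk64 := (TieChain.bf16_64_spec k (by omega)).2.2
  have hkq : (2 : ℚ) ≤ k := by exact_mod_cast (show 2 ≤ k by omega)
  refine ⟨fun x hx hlow hL => low_trajectory_ratio x hx (k + 1) hn hlow hL,
    ⟨TieChain.bf16_72, TieChain.bf16_72_mem, by rw [Nat.add_sub_cancel]; exact lowTraj_bf16_72 k,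
      by rw [hk72]; linarith, TieChain.bf16_72_ratio (k + 1) (by omega)⟩,
    ⟨TieChain.bf16_64, TieChain.bf16_64_mem, by rw [Nat.add_sub_cancel]; exact lowTraj_bf16_64 k,
      by rw [hk64]; linarith, TieChain.bf16_64_ratio (k + 1) hn⟩⟩

end MiniFloat

end Literature.ComputerArithmetic.FloatingPoint
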